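import Summits.ResolutionOfSingularities.ResolutionOfSingularities.Theorems.FrobeniusClosingSteerWords07SteeredLeaves
import Summits.ResolutionOfSingularities.ResolutionOfSingularities.Theorems.FrobeniusClosingSteerAutoPermissibleTwo
import Literature.AlgebraicGeometry.Resolution.RsopMonomialIdeals
import Literature.AlgebraicGeometry.Resolution.LogRegularCompleteStructure
import HarnessLib

/-!
# Crux `Steer` (stmt-ResolutionOfSingularities-16345), chain W4.1 — K-β4 `LegalityDebt` (the T-leg of the β-line):
# at a point step of a `p = 2` run with no singular surface, NO regular curve `𝔭 = (u₁, u₂, u₃)` has `f ≡ □ (mod 𝔭²)`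

OURS (campaign `res-hironaka`, rung L ★L-G4, slot W4.1; seat res-L0-w41-stub-4 g7 on res-L0-w41-plan-1 RULING 140
2026-08-27T13:31:16Z «stub-4 g7 = K-β4 `LegalityDebt` KERNEL», res-L0-w41-tri-2's proof sketch; the statement is
res-L0-w41-idea-1's `Sketch-idea-1-v15-betadebts.lean` §3 `LegalityDebt` VERBATIM — audited PASS by tri-2,
`beta/audit_v15_betadebts.md` 0b5aa89a5a225197); replaces the role of no printed item; NOT a statement of the manuscript
under review [claim: Hironaka2017, status: under-review]; AI-produced, weaker than expert review. Theses-free and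
definition-free: the words `IsPointStep` (Words07 §σ2.10), `IsSingPrime` / `IsTopSingComponent` / `IsPermissibleCentre` /
`IsSigmaTopCentre` (Words06 §3.2) are the TREE's; idea-1's §0 word `NoSingularSurfaceAt R s 2 i` (tri-2 F1 / strat-2 (g″0);
not yet a tree declaration) is INLINED as its body, so the leaf `legalityDebt_holds : LegalityDebt` is a λ-repackaging by
definitional unfolding once the word is hoisted.

* `isSingPrime_of_add_sq_mem_sq` — characteristic `2`: `f + q² ∈ P²` makes `P` a singular prime of `T² = f`
  (res-type-082's `AutoPermissible.singular_atPrime_of_sub_pow_mem_sq`, `f − q² = f + q² − 2q²`).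
* `one_le_ringKrullDim_quotient_of_ne_maximalIdeal`, `two_le_ringKrullDim_quotient_of_lt` — chains `Q < 𝔭 < 𝔪`
  (Literature `LogRegularCompleteStructure.succ_le_ringKrullDim_quotient_of_lt`).
* **`isPermissibleCentre_of_add_sq_mem_sq`** — the POSITIVE content: on a regular local member `R ⊆ K` (`char K = 2`),
  if every singular prime `Q` of `T² = f` has `dim R ⧸ Q ≤ 1` («no singular surface»), then a regular curve
  `𝔭 = (u₁, u₂, u₃) ≠ 𝔪` (`uᵢ` part of a regular system of parameters) with `f + q² ∈ 𝔭²` IS a σ_top-permissible centre: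
  singular prime (above), minimal among singular primes and of maximal dimension among them (a singular prime strictly
  below `𝔭` would be a singular surface), `R ⧸ 𝔭` regular (Matsumura 14.2), cleaner `q`.
* `not_isSigmaTopCentre_maximalIdeal_of_isPermissibleCentre` — a permissible centre forbids the point step (pure logic on
  the word `IsSigmaTopCentre`).
* **`legalityDebt`** — K-β4 VERBATIM: at a point step (`P i = 𝔪`) whose centre is the σ_top centre, under «no singular
  surface», `s i ^ 2 + q ^ 2 ∉ (u₁, u₂, u₃)²` for every such curve and every `q`. Consequence recorded by idea-1
  (`not_alphaGe_one_of_strongLegality`, v15 §3): `α* < 1` at every A-stage point step — the only legality input of the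
  β-block lemma.

[cite: Matsumura1987, Thm. 14.2] [folklore]
bears_on: LADDER-RESOLUTION L ★L-G4 W4.1 (crux `Steer`, binder hK4′ / β-line, debt K-β4).
-/

noncomputable section

-- `Summit.<S>.<S>.…` duplicates the summit name by design (single-problem summit).
set_option linter.dupNamespace false

open IsLocalRing

namespace Summit.ResolutionOfSingularities.ResolutionOfSingularities.Theorems.SwitchingDichotomy.BetaLegality

open Literature.AlgebraicGeometry.Resolution
open Summit.ResolutionOfSingularities.ResolutionOfSingularities.Theorems.SwitchingDichotomy.Words

variable {K : Type} [Field K]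

/-! ## §1 Singular primes from `f + q² ∈ P²` -/

/-- In characteristic `2`, `f + q² ∈ P²` makes `P` a SINGULAR PRIME of the torsor `T² = f` over the regular local member
`R ⊆ K` (`f − q² = (f + q²) − 2·q²` and res-type-082's criterion `AutoPermissible.singular_atPrime_of_sub_pow_mem_sq`).
[cite: Matsumura1987, Thm. 14.2] -/
theorem isSingPrime_of_add_sq_mem_sq [CharP K 2] (R : Subring K) [IsRegularLocalRing R] (f q : R) (P : Ideal R)
    [P.IsPrime] (h : f + q ^ 2 ∈ P ^ 2) : IsSingPrime R 2 f P := by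
  have h' : f - q ^ 2 ∈ P ^ 2 := by
    have h2 : (2 : R) = 0 := CharTwo.two_eq_zero
    rw [show f - q ^ 2 = (f + q ^ 2) - 2 * q ^ 2 by ring, h2, zero_mul, sub_zero]
    exact h
  exact AutoPermissible.singular_atPrime_of_sub_pow_mem_sq K 2 R f P h'

/-! ## §2 Chains of primes `Q < 𝔭 < 𝔪` -/

/-- A prime `𝔭 ≠ 𝔪` of a local ring has `1 ≤ dim R ⧸ 𝔭` (the chain `𝔭 < 𝔪`). [folklore] -/
theorem one_le_ringKrullDim_quotient_of_ne_maximalIdeal {R : Type} [CommRing R] [IsLocalRing R] (P : Ideal R)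
    [hP : P.IsPrime] (hne : P ≠ maximalIdeal R) : (1 : WithBot ℕ∞) ≤ ringKrullDim (R ⧸ P) := by
  have hlt : P < maximalIdeal R := lt_of_le_of_ne (IsLocalRing.le_maximalIdeal hP.ne_top) hne
  have h0 : ((0 : ℕ) : WithBot ℕ∞) ≤ ringKrullDim (R ⧸ maximalIdeal R) := by
    haveI : Nontrivial (R ⧸ maximalIdeal R) := Ideal.Quotient.nontrivial_iff.mpr (maximalIdeal.isMaximal R).ne_top
    exact_mod_cast ringKrullDim_nonneg_of_nontrivial
  have := LogRegularCompleteStructure.succ_le_ringKrullDim_quotient_of_lt hlt 0 h0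
  simpa using this

/-- If `Q < 𝔭` are primes of a local ring with `𝔭 ≠ 𝔪`, then `2 ≤ dim R ⧸ Q` (the chain `Q < 𝔭 < 𝔪`). [folklore] -/
theorem two_le_ringKrullDim_quotient_of_lt {R : Type} [CommRing R] [IsLocalRing R] {Q P : Ideal R} [Q.IsPrime]
    [P.IsPrime] (hQP : Q < P) (hne : P ≠ maximalIdeal R) : (2 : WithBot ℕ∞) ≤ ringKrullDim (R ⧸ Q) := by
  have h1 : ((1 : ℕ) : WithBot ℕ∞) ≤ ringKrullDim (R ⧸ P) := by
    exact_mod_cast one_le_ringKrullDim_quotient_of_ne_maximalIdeal P hne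
  have := LogRegularCompleteStructure.succ_le_ringKrullDim_quotient_of_lt hQP 1 h1
  exact_mod_cast this

/-! ## §3 The positive content: a regular curve with `f ≡ □ (mod 𝔭²)` is a permissible centre -/

/-- The ideal of the triple `![u₁, u₂, u₃]` is `(u₁, u₂, u₃)`. -/
theorem span_range_vec3 {R : Type} [CommRing R] (u₁ u₂ u₃ : R) :
    Ideal.span (Set.range ![u₁, u₂, u₃]) = Ideal.span {u₁, u₂, u₃} := by
  congr 1
  ext a
  simp only [Set.mem_range, Set.mem_insert_iff, Set.mem_singleton_iff]
  constructor
  · rintro ⟨j, rfl⟩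
    fin_cases j <;> simp
  · rintro (rfl | rfl | rfl)
    exacts [⟨0, rfl⟩, ⟨1, rfl⟩, ⟨2, rfl⟩]

/-- **A regular curve modulo whose square the radicand is a square is σ_top-PERMISSIBLE under «no singular surface»**
(`p = 2`). Let `R ⊆ K` be a regular local member, `char K = 2`, `f ∈ R`, and suppose every singular prime `Q` of
`T² = f` has `dim R ⧸ Q ≤ 1`. If `u₁, u₂, u₃` are part of a regular system of parameters with `𝔭 = (u₁, u₂, u₃) ≠ 𝔪` and
`f + q² ∈ 𝔭²`, then `IsPermissibleCentre R 2 f 𝔭`: `𝔭` is a singular prime (§1), minimal among singular primes and of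
maximal dimension (a singular prime `Q < 𝔭` would have `dim R ⧸ Q ≥ 2`, §2), `R ⧸ 𝔭` is regular (Matsumura 14.2, tree
`IsRsopPart.isRegularLocalRing_quotient`), and `q` is a cleaner (`f − q² = f + q²` in characteristic `2`).
[cite: Matsumura1987, Thm. 14.2] -/
theorem isPermissibleCentre_of_add_sq_mem_sq [CharP K 2] (R : Subring K) [IsRegularLocalRing R] (f q u₁ u₂ u₃ : R)
    (hu : IsRsopPart ![u₁, u₂, u₃]) (hne : Ideal.span {u₁, u₂, u₃} ≠ maximalIdeal R)
    (hNS : ∀ (Q : Ideal R) [Q.IsPrime], IsSingPrime R 2 f Q → ringKrullDim (R ⧸ Q) ≤ 1)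
    (h : f + q ^ 2 ∈ Ideal.span {u₁, u₂, u₃} ^ 2) :
    IsPermissibleCentre R 2 f (Ideal.span {u₁, u₂, u₃}) := by
  -- the curve `𝔭 = (u₁, u₂, u₃)` is prime with regular quotient
  have hprime : (Ideal.span ({u₁, u₂, u₃} : Set R)).IsPrime := by
    rw [← span_range_vec3]; exact hu.isPrime_span_range
  have hreg : IsRegularLocalRing (R ⧸ Ideal.span ({u₁, u₂, u₃} : Set R)) := by
    rw [← span_range_vec3]; exact hu.isRegularLocalRing_quotient
  haveI := hprime
  -- singular prime
  have hsing : IsSingPrime R 2 f (Ideal.span {u₁, u₂, u₃}) := isSingPrime_of_add_sq_mem_sq R f q _ h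
  -- dimension one
  have hdim1 : (1 : WithBot ℕ∞) ≤ ringKrullDim (R ⧸ Ideal.span ({u₁, u₂, u₃} : Set R)) :=
    one_le_ringKrullDim_quotient_of_ne_maximalIdeal _ hne
  refine ⟨hne, ⟨hprime, hsing, fun Q _ hQ hle => ?_, fun Q _ hQ _ => (hNS Q hQ).trans hdim1⟩, hreg, q, ?_⟩
  · -- minimality: a singular prime strictly below `𝔭` would be a singular surface
    by_contra hQne
    have hlt : Q < Ideal.span ({u₁, u₂, u₃} : Set R) := lt_of_le_of_ne hle hQne
    have h2 := two_le_ringKrullDim_quotient_of_lt hlt hne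
    have h21 : (2 : WithBot ℕ∞) ≤ 1 := h2.trans (hNS Q hQ)
    exact absurd h21 (by decide)
  · -- the cleaner `q`: `f - q² = f + q²` in characteristic 2
    have h2 : (2 : R) = 0 := CharTwo.two_eq_zero
    rw [show f - q ^ 2 = (f + q ^ 2) - 2 * q ^ 2 by ring, h2, zero_mul, sub_zero]
    exact h

/-! ## §4 A permissible centre forbids the point step -/

/-- If some `Q` is a σ_top-permissible centre for `(R, f)`, then the closed point `𝔪` is NOT the σ_top centre (the point
step is taken only when no permissible positive-dimensional centre exists; and `𝔪` itself is never permissible, its first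
clause being `𝔪 ≠ 𝔪`). Pure logic on the word `IsSigmaTopCentre`. OURS. [folklore] -/
theorem not_isSigmaTopCentre_maximalIdeal_of_isPermissibleCentre (R : Subring K) [IsLocalRing R] (p : ℕ) (f : R)
    {Q : Ideal R} (hQ : IsPermissibleCentre R p f Q) : ¬ IsSigmaTopCentre R p f (maximalIdeal R) := by
  rintro (hperm | ⟨-, hnone, -⟩)
  · exact hperm.1 rfl
  · exact hnone Q hQ

/-! ## §5 K-β4 `LegalityDebt` VERBATIM (idea-1 v15 §3; `NoSingularSurfaceAt R s 2 i` inlined) -/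

/-- **K-β4 · LegalityDebt** (res-L0-w41-idea-1 `Sketch-idea-1-v15-betadebts.lean` §3, VERBATIM up to inlining the §0 word
`NoSingularSurfaceAt R s 2 i` by its body): at a point step `i` (`P i = 𝔪`) of a `p = 2` run whose centre is the σ_top
centre and which satisfies «no singular surface» (every singular prime `Q` of `T² = s i ^ 2` has `dim (R i ⧸ Q) ≤ 1`), NO
regular curve-prime `𝔭 = (u₁, u₂, u₃) ≠ 𝔪` (part of a regular system of parameters of the regular local ring `R i`) has
`s i ^ 2 + q² ∈ 𝔭²` — otherwise `𝔭` would be permissible (§3) and σ_top would not have taken the point step (§4).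
Consequence (idea-1 v15 `not_alphaGe_one_of_strongLegality`): `α* < 1` at A-stage point steps. OURS. [folklore] -/
theorem legalityDebt (K : Type) [Field K] [CharP K 2] (R : ℕ → Subring K) (P : (i : ℕ) → Ideal (R i)) (s : ℕ → K)
    (i : ℕ) (hloc : IsLocalRing (R i)) (hs : s i ^ 2 ∈ R i) :
    IsRegularLocalRing (R i) → IsPointStep R P i →
    IsSigmaTopCentre (R i) 2 ⟨s i ^ 2, hs⟩ (P i) →
    (∀ (hs : s i ^ 2 ∈ R i) (Q : Ideal (R i)) [Q.IsPrime],
      IsSingPrime (R i) 2 ⟨s i ^ 2, hs⟩ Q → ringKrullDim (R i ⧸ Q) ≤ 1) →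
    ∀ (u₁ u₂ u₃ q : R i), IsRsopPart ![u₁, u₂, u₃] → Ideal.span {u₁, u₂, u₃} ≠ maximalIdeal (R i) →
      (⟨s i ^ 2, hs⟩ : R i) + q ^ 2 ∉ Ideal.span {u₁, u₂, u₃} ^ 2 := by
  intro hreg hpt hσ hNS u₁ u₂ u₃ q hu hne hmem
  haveI := hreg
  have hperm : IsPermissibleCentre (R i) 2 ⟨s i ^ 2, hs⟩ (Ideal.span {u₁, u₂, u₃}) :=
    isPermissibleCentre_of_add_sq_mem_sq (R i) ⟨s i ^ 2, hs⟩ q u₁ u₂ u₃ hu hne (fun Q _ hQ => hNS hs Q hQ) hmem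
  obtain ⟨_, hPi⟩ := hpt
  rw [hPi] at hσ
  exact not_isSigmaTopCentre_maximalIdeal_of_isPermissibleCentre (R i) 2 ⟨s i ^ 2, hs⟩ hperm hσ

end Summit.ResolutionOfSingularities.ResolutionOfSingularities.Theorems.SwitchingDichotomy.BetaLegality

end
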